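import Mathlib.Analysis.Complex.ExponentialBounds
import Mathlib.Analysis.Real.Pi.Bounds
import Literature.NumberTheory.LFunctions.WeilArchimedeanMoments
import Literature.NumberTheory.LFunctions.WeilPositivityMinorant
import Literature.NumberTheory.LFunctions.WeilPositivityAlgebra
import HarnessLib

/-!
# Weil positivity at the archimedean place: the certificate and its soundness

H. Yoshida (*On Hermitian forms attached to zeta functions*, Adv. Stud. Pure Math. 21 (1992),
Theorem 1, p. 310) proves that Weil's hermitian form is non-negative on `K(a)`, `a = (log 2)/2`,
by an analytic reduction (§§2, 5, 6: the explicit formula (2.1) with no prime term, the series and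
monotonicity of `Re ψ(1/4 + it/2)`, tail bounds (6.5)–(6.7), closed forms (5.15)–(5.16) of the
matrix coefficients) followed by a finite machine computation ("verified rather easily on a
computer": a `10 × 10` matrix for odd `φ` and a `200 × 200` interval Gaussian elimination for even
`φ`, §6 pp. 310–325). This file implements a reduction of the same kind whose finite part is
checked by the Lean kernel (`decide`), for the restriction of Theorem 1 to `C(a)` that is the
named fact `Literature.NumberTheory.LFunctions.weilPositivityOn_log_two_half`
(`Literature/NumberTheory/LFunctions/WeilArchimedeanPositivity.lean`), in the analytic form
`E(g) = 2 Re(ĝ(0) conj ĝ(1)) − (log π)‖g‖₂² + (1/2π) ∫ |ĝ(1/2+it)|² Re ψ(1/4+it/2) dt`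
(`Literature.NumberTheory.LFunctions.weilArchQuadratic`, `WeilArchimedeanPositivityProofs.lean`).

## The reduction (all constants rational; `a₀ ≥ (log 2)/2`, moments `M_k = ∫ g(x)(x/a₀)^k dx`, `k ≤ N`)

* polar term: Taylor expansion of `e^{±x/2}` to order `N` (`WeilArchimedeanMoments`):
  `2 Re(ĝ(0) conj ĝ(1)) ≥ Σ Sym_{kl} Re(conj M_k M_l) − η_P ‖g‖₁²`;
* archimedean integral: a certified minorant `wL − γ ≤ Re ψ(1/4 + it/2)`
  (`WeilPositivityMinorant`) and Plancherel give
  `(1/2π) ∫ |ĝ|² Re ψ ≥ wL ‖g‖₂² − q ∫ |ĝ|² γ` (`q ≥ 1/2π`); Taylor expansion of `e^{itx}` on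
  `|t| ≤ T` bounds `∫ |ĝ|² γ` by `Σ Ĝ_{kl} Re(conj M_k M_l) + 5 ‖g‖₁² ν'` with `Ĝ` built from the
  exact rational moments `ν_q = a₀^q ∫ γ t^q` of the minorant;
* `‖g‖₁² ≤ 2a₀ ‖g‖₂²`, rounding of the matrix `P = Sym − qĜ` to dyadics, and Bessel's inequality
  `‖g‖₂² ≥ 2 Re⟨u, M⟩ − u* H u` for the vector `u` encoded by the certificate (Legendre-type change
  of basis `C`, `D = C⁻¹`, weights `b`), reduce `E(g) ≥ 0` to the positivity of two real
  `(N+1)/2 × (N+1)/2` matrices `S'_p = Dᵀ P_r D + κ (2 diag b − b bᵀ ∘ C H Cᵀ)` (`p` = parity),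
  certified by `S'_p = R + UᵀU` with `R` diagonally dominant (`WeilPositivityAlgebra`).

## Contents

* `WeilCert` (the certificate format), the computable checker `WeilCert.check` (cells, scalar
  side conditions, the two parity blocks) — every table is materialized as a list (`tabV`,
  `tabM`) so that `decide +kernel` evaluates it once;
* soundness: `WeilCert.core_nonneg` (the algebraic core), `WeilAna.polar_lower_bound`,
  `WeilAna.freq_pointwise_bound`, `WeilCert.freq_integral_bound`, `WeilCert.arch_lower_bound`
  and the main theorem **`WeilCert.weilArchQuadratic_nonneg_of_check`**:
  `c.check = true → ∀ g, IsWeilTest g → tsupport g ⊆ [-(log 2)/2, (log 2)/2] → 0 ≤ E(g)`.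

The certificate itself (77 cells, `N = 43`, `T = 33`, `a₀ = 355/1024`) and the kernel
evaluation of `check` are in `WeilPositivityCertificateData.lean` and its siblings; the
discharge `weilPositivityOn_log_two_half_holds` is in `WeilArchimedeanPositivityHolds.lean`.
Everything here is proved; there are no named facts.

## References

* H. Yoshida, *On Hermitian forms attached to zeta functions*, Adv. Stud. Pure Math. 21 (1992),
  281–325: §2 (2.1), §6 (6.1)–(6.9), Theorem 1 (p. 310).
* E. Bombieri, *Remarks on Weil's quadratic functional in the theory of prime numbers I*, Rend.
  Mat. Acc. Lincei (9) 11 (2000), §1 (report of Yoshida's computation for `t = (log 2)/2`).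
-/

noncomputable section

open Complex Finset MeasureTheory Set Filter
open scoped Real Topology ComplexConjugate BigOperators

namespace Literature.NumberTheory.LFunctions


/-! ## List accessors and tabulation -/

/-- `i`-th entry of a rational vector (zero beyond the end). [folklore] -/
def getV (v : List ℚ) (i : ℕ) : ℚ := v.getD i 0

/-- `(i,j)` entry of a rational matrix given as a list of rows (zero beyond the end). [folklore] -/
def getM (A : List (List ℚ)) (i j : ℕ) : ℚ := (A.getD i []).getD j 0

/-- Tabulate `f` on `range n` as a list. [folklore] -/
def tabV (n : ℕ) (f : ℕ → ℚ) : List ℚ := (List.range n).map f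

/-- Tabulate `f` on `range n × range n` as a list of rows. [folklore] -/
def tabM (n : ℕ) (f : ℕ → ℕ → ℚ) : List (List ℚ) :=
  (List.range n).map fun i ↦ (List.range n).map (f i)

/-- `tabV` tabulates `f`. [folklore] -/
theorem getV_tabV {n : ℕ} (f : ℕ → ℚ) {i : ℕ} (hi : i < n) : getV (tabV n f) i = f i := by
  unfold getV tabV
  rw [List.getD_eq_getElem?_getD, List.getElem?_map, List.getElem?_range hi]
  rfl

/-- `tabM` tabulates `f`. [folklore] -/
theorem getM_tabM {n : ℕ} (f : ℕ → ℕ → ℚ) {i j : ℕ} (hi : i < n) (hj : j < n) :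
    getM (tabM n f) i j = f i j := by
  unfold getM tabM
  have h1 : ((List.range n).map fun i ↦ (List.range n).map (f i)).getD i [] =
      (List.range n).map (f i) := by
    rw [List.getD_eq_getElem?_getD, List.getElem?_map, List.getElem?_range hi]
    rfl
  rw [h1, List.getD_eq_getElem?_getD, List.getElem?_map, List.getElem?_range hj]
  rfl

/-! ## Theorem-backed rational constants -/

/-- `log π ≤ 1.1447299` (`Real.log_pi_le`). [folklore] -/
def logPiHi : ℚ := 11447299 / 10000000

/-- `3.141592 < π` (`Real.pi_gt_d6`). [folklore] -/
def piLo : ℚ := 3141592 / 1000000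

/-- An upper bound for `1/(2π)`. [folklore] -/
def invTwoPiHi : ℚ := 1 / (2 * piLo)

/-- `log 2 < 0.6931471808` (`Real.log_two_lt_d9`). [folklore] -/
def logTwoHi : ℚ := 6931471808 / 10000000000

/-! ## The certificate -/

/-- A certificate for Weil positivity on `[-a₀, a₀] ⊇ [-(log 2)/2, (log 2)/2]`: the parameters of the
moment method (`a₀, N, T`), a certified minorant of the weight (`wL`, cells), and, for each parity
block, the Legendre-type change of basis `C` with its inverse `D` and a PSD factor `U`. [folklore] -/
structure WeilCert where
  /-- half-length of the support interval (rational, `≥ (log 2)/2`) -/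
  a0 : ℚ
  /-- degree of the Taylor/moment truncation -/
  N : ℕ
  /-- frequency cut-off of the minorant -/
  T : ℚ
  /-- constant level of the minorant beyond `T` -/
  wL : ℚ
  /-- series terms for the check `wL ≤ Re ψ(1/4 + iT/2)` -/
  mwT : ℕ
  /-- rounding bits of the cell data -/
  prec : ℕ
  /-- rounding bits of the matrix data -/
  pg : ℕ
  /-- the cells of the minorant on `[0, T]` -/
  cells : List WeilCell
  /-- change of basis, even block -/
  CE : List (List ℚ)
  /-- change of basis, odd block -/
  CO : List (List ℚ)
  /-- inverse change of basis, even block -/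
  DE : List (List ℚ)
  /-- inverse change of basis, odd block -/
  DO : List (List ℚ)
  /-- PSD factor, even block -/
  UE : List (List ℚ)
  /-- PSD factor, odd block -/
  UO : List (List ℚ)

namespace WeilCert

variable (c : WeilCert)

/-- Block size `(N+1)/2`. [folklore] -/
def nb : ℕ := (c.N + 1) / 2

/-- Change of basis of the parity block `p`. [folklore] -/
def Cb (p : ℕ) : List (List ℚ) := if p = 0 then c.CE else c.CO
/-- Inverse change of basis of the parity block `p`. [folklore] -/
def Db (p : ℕ) : List (List ℚ) := if p = 0 then c.DE else c.DO
/-- PSD factor of the parity block `p`. [folklore] -/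
def Ub (p : ℕ) : List (List ℚ) := if p = 0 then c.UE else c.UO

/-- The scaled moments `ν_q = a₀^q ∫ γ(t) t^q dt = a₀^q · 2 · Σ_j momentQ_j(q)` of the minorant. [folklore] -/
def nuQ (q : ℕ) : ℚ := c.a0 ^ q * (2 * cellsMomentQ c.wL c.cells q)

/-- Table of `ν_q`, `q ≤ 2N`. [folklore] -/
def nuTab : List ℚ := tabV (2 * c.N + 1) c.nuQ

/-- Taylor coefficients `τ(d) = (a₀/2)^d/d!` of `e^{±x/2}` in the moments. [folklore] -/
def tauQ (d : ℕ) : ℚ := (c.a0 / 2) ^ d / d.factorial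

/-- The exact matrix `P = Sym − q Ĝ` of the reduced quadratic form (full indices `k, l ≤ N`; zero
across parities): `Sym_{kl} = 2(−1)^k τ(k)τ(l)`, `Ĝ_{kl} = (−1)^k (−1)^{(k+l)/2} ν_{k+l}/(k! l!)`. [folklore] -/
def pmQ (nu : List ℚ) (k l : ℕ) : ℚ :=
  if k % 2 = l % 2 then
    (-1 : ℚ) ^ k * 2 * c.tauQ k * c.tauQ l -
      invTwoPiHi * ((-1 : ℚ) ^ k * (-1 : ℚ) ^ ((k + l) / 2) * getV nu (k + l) /
        (k.factorial * l.factorial))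
  else 0

/-- The rounded matrix `P_r = rd(P)`. [folklore] -/
def prQ (nu : List ℚ) (k l : ℕ) : ℚ := ratRd c.pg (c.pmQ nu k l)

/-- Parity block `p` of `P_r`, materialized. [folklore] -/
def prBlk (nu : List ℚ) (p : ℕ) : List (List ℚ) :=
  tabM c.nb fun i j ↦ c.prQ nu (2 * i + p) (2 * j + p)

/-- Taylor remainder constant `ρ_e = 2 (a₀/2)^{N+1}/(N+1)!` of `e^{±x/2}`. [folklore] -/
def rhoE : ℚ := 2 * (c.a0 / 2) ^ (c.N + 1) / (c.N + 1).factorial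

/-- Polar error constant `η_P = 8ρ_e + 6ρ_e²`. [folklore] -/
def etaP : ℚ := 8 * c.rhoE + 6 * c.rhoE ^ 2

/-- `ν' = 2 ν_{N+1}/(N+1)!`, the `γ`-moment of the Taylor remainder in `t`. [folklore] -/
def nuPrime (nu : List ℚ) : ℚ := 2 * getV nu (c.N + 1) / (c.N + 1).factorial

/-- The coefficient of `‖g‖₂²` after all reductions, before rounding. [folklore] -/
def kappaExact (nu : List ℚ) : ℚ :=
  c.wL - logPiHi -
    2 * c.a0 * (c.etaP + 5 * invTwoPiHi * c.nuPrime nu + ((c.N : ℚ) + 1) ^ 2 / 2 ^ c.pg)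

/-- `κ = rd(κ_exact)`. [folklore] -/
def kappaQ (nu : List ℚ) : ℚ := ratRd c.pg (c.kappaExact nu)

/-- Gram block `H_{ij} = 2a₀/(d_i + d_j + 1)`, `d_i = 2i + p`. [folklore] -/
def hBlkQ (p i j : ℕ) : ℚ := 2 * c.a0 / ((2 * i + p : ℕ) + (2 * j + p : ℕ) + 1)

/-- `C H`, materialized. [folklore] -/
def chBlk (p : ℕ) : List (List ℚ) :=
  tabM c.nb fun i l ↦ sumR c.nb fun k ↦ getM (c.Cb p) i k * c.hBlkQ p k l

/-- `H' = C H Cᵀ`, materialized. [folklore] -/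
def hpBlk (p : ℕ) : List (List ℚ) :=
  let ch := c.chBlk p
  tabM c.nb fun i j ↦ sumR c.nb fun l ↦ getM ch i l * getM (c.Cb p) j l

/-- Bessel weights `b_i = (2 d_i + 1)/(2a₀)`. [folklore] -/
def bQ (p i : ℕ) : ℚ := (2 * ((2 * i + p : ℕ) : ℚ) + 1) / (2 * c.a0)

/-- `P_r D`, materialized. [folklore] -/
def pdBlk (nu : List ℚ) (p : ℕ) : List (List ℚ) :=
  let pr := c.prBlk nu p
  tabM c.nb fun k j ↦ sumR c.nb fun l ↦ getM pr k l * getM (c.Db p) l j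

/-- `S' = Dᵀ P_r D + κ (2 diag b − (b bᵀ) ∘ H')`, materialized. [folklore] -/
def spBlk (nu : List ℚ) (p : ℕ) : List (List ℚ) :=
  let pd := c.pdBlk nu p
  let hp := c.hpBlk p
  let κ := c.kappaQ nu
  tabM c.nb fun i j ↦
    (sumR c.nb fun k ↦ getM (c.Db p) k i * getM pd k j) +
      κ * ((if i = j then 2 * c.bQ p i else 0) - c.bQ p i * c.bQ p j * getM hp i j)

/-- `R = S' − Uᵀ U`, materialized. [folklore] -/
def rBlk (nu : List ℚ) (p : ℕ) : List (List ℚ) :=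
  let sp := c.spBlk nu p
  tabM c.nb fun i j ↦ getM sp i j - sumR c.nb fun k ↦ getM (c.Ub p) k i * getM (c.Ub p) k j

/-- Diagonal dominance `Σ_{j ≠ i} (|R_{ij}| + |R_{ji}|)/2 ≤ R_{ii}`. [folklore] -/
def checkDom (nb : ℕ) (R : List (List ℚ)) : Bool :=
  allBelow nb fun i ↦
    decide ((sumR nb fun j ↦ if j = i then 0 else (|getM R i j| + |getM R j i|) / 2) ≤ getM R i i)

/-- `D C = I` on the block. [folklore] -/
def checkDC (p : ℕ) : Bool :=
  allBelow c.nb fun i ↦ allBelow c.nb fun j ↦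
    decide ((sumR c.nb fun k ↦ getM (c.Db p) i k * getM (c.Cb p) k j) = if i = j then 1 else 0)

/-- All checks of the parity block `p`. [folklore] -/
def checkBlock (nu : List ℚ) (p : ℕ) : Bool :=
  c.checkDC p && checkDom c.nb (c.rBlk nu p)

/-- Scalar side conditions. [folklore] -/
def checkScalars (nu : List ℚ) : Bool :=
  decide (logTwoHi ≤ 2 * c.a0) && decide (c.a0 ≤ 1) && decide (0 < c.T) &&
    decide (2 * c.a0 * c.T ≤ (c.N : ℚ) + 2) &&
    decide (2 * (c.a0 * c.T) ^ (c.N + 1) / (c.N + 1).factorial ≤ 1) &&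
    decide (c.N + 1 = 2 * c.nb) && decide (0 ≤ c.kappaQ nu)

/-- **The checker.** [folklore] -/
def check : Bool :=
  checkCells c.prec c.wL c.T c.mwT c.cells && c.checkScalars c.nuTab &&
    c.checkBlock c.nuTab 0 && c.checkBlock c.nuTab 1

end WeilCert




namespace WeilAna

variable {g : ℝ → ℂ}

/-- `Re(z conj w) = Re(conj z · w)`. [folklore] -/
theorem re_mul_conj_eq (z w : ℂ) : (z * conj w).re = (conj z * w).re := by
  simp only [Complex.mul_re, Complex.conj_re, Complex.conj_im]
  ring

/-- Real bilinear expansion: `Re((Σ τ_k M_k) conj(Σ σ_l M_l)) = Σ_{kl} τ_k σ_l Re(conj M_k M_l)`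
for real coefficient vectors. [folklore] -/
theorem re_sum_mul_conj_sum (n : ℕ) (τ σ : ℕ → ℝ) (M : ℕ → ℂ) :
    ((∑ k ∈ range n, (τ k : ℂ) * M k) * conj (∑ l ∈ range n, (σ l : ℂ) * M l)).re =
      ∑ k ∈ range n, ∑ l ∈ range n, τ k * σ l * (conj (M k) * M l).re := by
  rw [map_sum, Finset.sum_mul_sum, Complex.re_sum]
  refine Finset.sum_congr rfl fun k _ ↦ ?_
  rw [Complex.re_sum]
  refine Finset.sum_congr rfl fun l _ ↦ ?_
  rw [map_mul, Complex.conj_ofReal]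
  have : (τ k : ℂ) * M k * ((σ l : ℂ) * conj (M l)) = ((τ k * σ l : ℝ) : ℂ) * (M k * conj (M l)) := by
    push_cast; ring
  rw [this, Complex.re_ofReal_mul, re_mul_conj_eq]

/-- `‖Σ τ_m M_m‖² = Σ_{kl} Re(conj(τ_k) τ_l conj(M_k) M_l)`. [folklore] -/
theorem norm_sq_sum_eq (n : ℕ) (τ : ℕ → ℂ) (M : ℕ → ℂ) :
    ‖∑ m ∈ range n, τ m * M m‖ ^ 2 =
      ∑ k ∈ range n, ∑ l ∈ range n, (conj (τ k) * τ l * (conj (M k) * M l)).re := by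
  rw [Complex.sq_norm, ← Complex.ofReal_re (Complex.normSq _), Complex.normSq_eq_conj_mul_self, map_sum,
    Finset.sum_mul_sum, Complex.re_sum]
  refine Finset.sum_congr rfl fun k _ ↦ ?_
  rw [Complex.re_sum]
  refine Finset.sum_congr rfl fun l _ ↦ ?_
  rw [map_mul]
  ring_nf

/-- The error algebra of the polar term: if `‖A‖, ‖B‖ ≤ 2L`, `‖A − p‖, ‖B − q‖ ≤ ρL` (`ρ, L ≥ 0`)
then `2 Re(A conj B) ≥ 2 Re(p conj q) − (8ρ + 6ρ²) L²`. [folklore] -/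
theorem polar_error {A B p q : ℂ} {L ρ : ℝ} (hL : 0 ≤ L) (hρ : 0 ≤ ρ) (hA : ‖A‖ ≤ 2 * L)
    (hB : ‖B‖ ≤ 2 * L) (hp : ‖A - p‖ ≤ ρ * L) (hq : ‖B - q‖ ≤ ρ * L) :
    2 * (p * conj q).re - (8 * ρ + 6 * ρ ^ 2) * L ^ 2 ≤ 2 * (A * conj B).re := by
  set R0 := A - p with hR0
  set R1 := B - q with hR1
  have ep : p = A - R0 := by rw [hR0]; ring
  have eq' : q = B - R1 := by rw [hR1]; ring
  have hpn : ‖p‖ ≤ (2 + ρ) * L := by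
    rw [ep]; refine (norm_sub_le _ _).trans ?_; nlinarith
  have hqn : ‖q‖ ≤ (2 + ρ) * L := by
    rw [eq']; refine (norm_sub_le _ _).trans ?_; nlinarith
  have key : A * conj B - p * conj q = p * conj R1 + R0 * conj q + R0 * conj R1 := by
    rw [ep, eq', hR0, hR1]
    simp only [map_sub]
    ring
  have hdiff : |(A * conj B).re - (p * conj q).re| ≤ (4 * ρ + 3 * ρ ^ 2) * L ^ 2 := by
    rw [← Complex.sub_re, key]
    refine (Complex.abs_re_le_norm _).trans ?_
    refine (norm_add_le _ _).trans ?_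
    refine (add_le_add (norm_add_le _ _) le_rfl).trans ?_
    simp only [norm_mul, Complex.norm_conj]
    have h1 : ‖p‖ * ‖R1‖ ≤ (2 + ρ) * L * (ρ * L) :=
      mul_le_mul hpn hq (norm_nonneg _) (by positivity)
    have h2 : ‖R0‖ * ‖q‖ ≤ ρ * L * ((2 + ρ) * L) :=
      mul_le_mul hp hqn (norm_nonneg _) (by positivity)
    have h3 : ‖R0‖ * ‖R1‖ ≤ ρ * L * (ρ * L) :=
      mul_le_mul hp hq (norm_nonneg _) (by positivity)
    nlinarith
  have := neg_abs_le ((A * conj B).re - (p * conj q).re)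
  nlinarith

/-- The error algebra of the frequency side: if `‖φ‖ ≤ L`, `‖φ − p‖ ≤ ρL`, `0 ≤ ρ ≤ 1`, `L ≥ 0` then
`‖φ‖² ≤ ‖p‖² + 5ρL²`. [folklore] -/
theorem freq_error {φ p : ℂ} {L ρ : ℝ} (hL : 0 ≤ L) (hρ : 0 ≤ ρ) (hρ1 : ρ ≤ 1) (hφ : ‖φ‖ ≤ L)
    (hp : ‖φ - p‖ ≤ ρ * L) : ‖φ‖ ^ 2 ≤ ‖p‖ ^ 2 + 5 * ρ * L ^ 2 := by
  have hpn : ‖p‖ ≤ (1 + ρ) * L := by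
    have : p = φ - (φ - p) := by ring
    rw [this]
    refine (norm_sub_le _ _).trans ?_
    nlinarith
  have h1 : ‖φ‖ ≤ ‖p‖ + ‖φ - p‖ := by
    have : φ = p + (φ - p) := by ring
    conv_lhs => rw [this]
    exact norm_add_le _ _
  have h2 : ‖φ‖ ^ 2 ≤ (‖p‖ + ρ * L) ^ 2 := by
    refine pow_le_pow_left₀ (norm_nonneg _) (h1.trans ?_) 2
    linarith
  have h4 : 2 * (ρ * L) * ‖p‖ ≤ 2 * (ρ * L) * ((1 + ρ) * L) :=
    mul_le_mul_of_nonneg_left hpn (by positivity)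
  have h5 : ρ ^ 2 ≤ ρ := by nlinarith
  have h6 : (2 * ρ + 3 * ρ ^ 2) * L ^ 2 ≤ 5 * ρ * L ^ 2 := by
    have : 2 * ρ + 3 * ρ ^ 2 ≤ 5 * ρ := by nlinarith
    exact mul_le_mul_of_nonneg_right this (sq_nonneg L)
  calc ‖φ‖ ^ 2 ≤ (‖p‖ + ρ * L) ^ 2 := h2
    _ = ‖p‖ ^ 2 + 2 * (ρ * L) * ‖p‖ + (ρ * L) ^ 2 := by ring
    _ ≤ ‖p‖ ^ 2 + 2 * (ρ * L) * ((1 + ρ) * L) + (ρ * L) ^ 2 := by linarith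
    _ = ‖p‖ ^ 2 + (2 * ρ + 3 * ρ ^ 2) * L ^ 2 := by ring
    _ ≤ ‖p‖ ^ 2 + 5 * ρ * L ^ 2 := by linarith

/-- The conjugate-product of the Taylor coefficients of `e^{itx}`:
`conj((ita)^k/k!) (ita)^l/l! = (−1)^k I^{k+l} · (ta)^{k+l}/(k! l!)`. [folklore] -/
theorem conj_tau_mul_tau (t a : ℝ) (k l : ℕ) :
    conj (((t : ℂ) * I * a) ^ k / k.factorial) * (((t : ℂ) * I * a) ^ l / l.factorial) =
      ((-1 : ℂ) ^ k * I ^ (k + l)) * (((t * a) ^ (k + l) / (k.factorial * l.factorial) : ℝ) : ℂ) := by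
  rw [map_div₀, map_pow, map_natCast]
  have hc : conj ((t : ℂ) * I * a) = -((t : ℂ) * I * a) := by
    simp [Complex.conj_ofReal, Complex.conj_I]
  rw [hc, neg_pow]
  push_cast
  rw [pow_add, pow_add, mul_pow, mul_pow, mul_pow, mul_pow]
  field_simp
  ring

/-- For even `q`, `I^q = (−1)^{q/2}`. [folklore] -/
theorem I_pow_even {q : ℕ} (hq : Even q) : (I : ℂ) ^ q = (-1 : ℂ) ^ (q / 2) := by
  obtain ⟨r, hr⟩ := hq
  have : q / 2 = r := by omega
  rw [this, hr, ← two_mul, pow_mul, Complex.I_sq]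

/-- **Polar lower bound (Yoshida (6.2), moment form).** For `tsupport g ⊆ [-a, a]`, `0 < a ≤ 1`:
`2 Re(ĝ(0) conj ĝ(1)) ≥ Σ_{k,l≤N} 2 τ₀(k) τ₁(l) Re(conj M_k M_l) − (8ρ + 6ρ²)‖g‖₁²`,
`τ₀(k) = (−a/2)^k/k!`, `τ₁(l) = (a/2)^l/l!`, `ρ = 2(a/2)^{N+1}/(N+1)!`. [folklore] -/
theorem polar_lower_bound (hg : IsWeilTest g) {a : ℝ} (ha : 0 < a) (ha1 : a ≤ 1)
    (hsupp : tsupport g ⊆ Icc (-a) a) (N : ℕ) :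
    ∑ k ∈ range (N + 1), ∑ l ∈ range (N + 1),
        (2 * ((-a / 2) ^ k / k.factorial) * ((a / 2) ^ l / l.factorial)) *
          (conj (weilMoment a g k) * weilMoment a g l).re -
        (8 * (2 * (a / 2) ^ (N + 1) / (N + 1).factorial) +
          6 * (2 * (a / 2) ^ (N + 1) / (N + 1).factorial) ^ 2) * weilNorm1 g ^ 2 ≤
      2 * (weilMellin g 0 * conj (weilMellin g 1)).re := by
  set ρ : ℝ := 2 * (a / 2) ^ (N + 1) / (N + 1).factorial with hρ
  set L := weilNorm1 g with hL
  have hL0 : 0 ≤ L := weilNorm1_nonneg g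
  have hρ0 : 0 ≤ ρ := by positivity
  -- Taylor at c = 1/2 and c = -1/2
  have hc1 : ‖(1 / 2 : ℂ)‖ * a / (N + 2) ≤ 1 / 2 := by
    rw [show ‖(1 / 2 : ℂ)‖ = 1 / 2 by simp]
    rw [div_le_iff₀ (by positivity)]
    have : (0 : ℝ) ≤ N := Nat.cast_nonneg N
    nlinarith
  have hc0 : ‖(-(1 / 2) : ℂ)‖ * a / (N + 2) ≤ 1 / 2 := by rwa [norm_neg]
  have h1 := norm_weilMellin_sub_sum_weilMoment_le hg ha hsupp (1 / 2 : ℂ) N hc1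
  have h0 := norm_weilMellin_sub_sum_weilMoment_le hg ha hsupp (-(1 / 2) : ℂ) N hc0
  rw [show (1 / 2 : ℂ) + 1 / 2 = 1 by norm_num, show ‖(1 / 2 : ℂ)‖ = 1 / 2 by simp] at h1
  rw [show (-(1 / 2) : ℂ) + 1 / 2 = 0 by norm_num, norm_neg, show ‖(1 / 2 : ℂ)‖ = 1 / 2 by simp] at h0
  rw [show (1 / 2 * a : ℝ) = a / 2 by ring] at h1 h0
  -- norms of ĝ(0), ĝ(1)
  have hB := norm_weilMellin_pm_half_le hg ha ha1 hsupp (σ := 1 / 2) (by norm_num)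
  have hA := norm_weilMellin_pm_half_le hg ha ha1 hsupp (σ := -(1 / 2)) (by norm_num)
  push_cast at hA hB
  rw [show (1 / 2 : ℂ) + 1 / 2 = 1 by norm_num] at hB
  rw [show (-(1 / 2) : ℂ) + 1 / 2 = 0 by norm_num] at hA
  -- identify the Taylor sums with real coefficient vectors
  set p1 : ℂ := ∑ m ∈ range (N + 1), (1 / 2 * (a : ℂ)) ^ m / m.factorial * weilMoment a g m with hp1
  set p0 : ℂ := ∑ m ∈ range (N + 1), (-(1 / 2) * (a : ℂ)) ^ m / m.factorial * weilMoment a g m with hp0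
  have ep1 : p1 = ∑ m ∈ range (N + 1), (((a / 2) ^ m / m.factorial : ℝ) : ℂ) * weilMoment a g m := by
    rw [hp1]; refine Finset.sum_congr rfl fun m _ ↦ ?_; push_cast; ring
  have ep0 : p0 = ∑ m ∈ range (N + 1), (((-a / 2) ^ m / m.factorial : ℝ) : ℂ) * weilMoment a g m := by
    rw [hp0]; refine Finset.sum_congr rfl fun m _ ↦ ?_; push_cast; ring
  have hmain := polar_error (A := weilMellin g 0) (B := weilMellin g 1) (p := p0) (q := p1) hL0 hρ0
    hA hB (by rw [hρ, hL]; exact h0) (by rw [hρ, hL]; exact h1)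
  have hre : (p0 * conj p1).re = ∑ k ∈ range (N + 1), ∑ l ∈ range (N + 1),
      ((-a / 2) ^ k / k.factorial) * ((a / 2) ^ l / l.factorial) *
        (conj (weilMoment a g k) * weilMoment a g l).re := by
    rw [ep0, ep1, re_sum_mul_conj_sum]
  rw [hre, Finset.mul_sum] at hmain
  refine le_trans (le_of_eq ?_) hmain
  congr 1
  refine Finset.sum_congr rfl fun k _ ↦ ?_
  rw [Finset.mul_sum]
  refine Finset.sum_congr rfl fun l _ ↦ ?_
  ring

/-- **Frequency-side pointwise bound.** For `tsupport g ⊆ [-a, a]`, `2a|t| ≤ N + 2` and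
`ρ_t = 2(|t|a)^{N+1}/(N+1)! ≤ 1`:
`‖ĝ(1/2+it)‖² ≤ Σ_{k,l≤N} Re((−1)^k I^{k+l} conj M_k M_l) (ta)^{k+l}/(k!l!) + 5 ρ_t ‖g‖₁²`. [folklore] -/
theorem freq_pointwise_bound (hg : IsWeilTest g) {a : ℝ} (ha : 0 < a)
    (hsupp : tsupport g ⊆ Icc (-a) a) (N : ℕ) {t : ℝ} (ht : 2 * a * |t| ≤ N + 2)
    (hρt : 2 * (|t| * a) ^ (N + 1) / (N + 1).factorial ≤ 1) :
    ‖weilMellin g (1 / 2 + t * I)‖ ^ 2 ≤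
      ∑ k ∈ range (N + 1), ∑ l ∈ range (N + 1),
          (((-1 : ℂ) ^ k * I ^ (k + l)) * (conj (weilMoment a g k) * weilMoment a g l)).re *
            ((t * a) ^ (k + l) / (k.factorial * l.factorial)) +
        5 * (2 * (|t| * a) ^ (N + 1) / (N + 1).factorial) * weilNorm1 g ^ 2 := by
  set L := weilNorm1 g with hL
  have hL0 : 0 ≤ L := weilNorm1_nonneg g
  have hc : ‖(t : ℂ) * I‖ * a / (N + 2) ≤ 1 / 2 := by
    rw [show ‖(t : ℂ) * I‖ = |t| by simp]
    rw [div_le_iff₀ (by positivity)]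
    linarith
  have h := norm_weilMellin_sub_sum_weilMoment_le hg ha hsupp ((t : ℂ) * I) N hc
  rw [show ‖(t : ℂ) * I‖ = |t| by simp, show (t : ℂ) * I + 1 / 2 = 1 / 2 + t * I by ring] at h
  set p : ℂ := ∑ m ∈ range (N + 1), ((t : ℂ) * I * a) ^ m / m.factorial * weilMoment a g m with hp
  have hφ := norm_weilMellin_half_line_le hg t
  have hmain := freq_error (φ := weilMellin g (1 / 2 + t * I)) (p := p) hL0 (by positivity) hρt hφ
    (by rw [hp]; exact h)
  refine hmain.trans (add_le_add (le_of_eq ?_) le_rfl)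
  rw [hp, norm_sq_sum_eq]
  refine Finset.sum_congr rfl fun k _ ↦ Finset.sum_congr rfl fun l _ ↦ ?_
  rw [conj_tau_mul_tau]
  rw [show ((-1 : ℂ) ^ k * I ^ (k + l)) * (((t * a) ^ (k + l) / (k.factorial * l.factorial) : ℝ) : ℂ) *
      (conj (weilMoment a g k) * weilMoment a g l) =
      ((-1 : ℂ) ^ k * I ^ (k + l)) * (conj (weilMoment a g k) * weilMoment a g l) *
        (((t * a) ^ (k + l) / (k.factorial * l.factorial) : ℝ) : ℂ) by ring, Complex.re_mul_ofReal]

end WeilAna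




namespace WeilCert

variable (c : WeilCert)

/-! ### Table lemmas: the materialized lists agree with their defining formulas -/

section Tables

variable (nu : List ℚ) (p : ℕ)

/-- Entries of the materialized block of `P_r`. [folklore] -/
theorem getM_prBlk {i j : ℕ} (hi : i < c.nb) (hj : j < c.nb) :
    getM (c.prBlk nu p) i j = c.prQ nu (2 * i + p) (2 * j + p) := by
  unfold prBlk; rw [getM_tabM _ hi hj]

/-- Entries of the materialized `P_r D`. [folklore] -/
theorem getM_pdBlk {k j : ℕ} (hk : k < c.nb) (hj : j < c.nb) :
    getM (c.pdBlk nu p) k j =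
      ∑ l ∈ range c.nb, c.prQ nu (2 * k + p) (2 * l + p) * getM (c.Db p) l j := by
  unfold pdBlk
  dsimp only
  rw [getM_tabM _ hk hj, sumR_eq_sum]
  exact Finset.sum_congr rfl fun l hl ↦ by rw [c.getM_prBlk nu p hk (Finset.mem_range.1 hl)]

/-- Entries of the materialized `H' = C H Cᵀ`. [folklore] -/
theorem getM_hpBlk {i j : ℕ} (hi : i < c.nb) (hj : j < c.nb) :
    getM (c.hpBlk p) i j =
      ∑ l ∈ range c.nb, (∑ k ∈ range c.nb, getM (c.Cb p) i k * c.hBlkQ p k l) * getM (c.Cb p) j l := by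
  unfold hpBlk
  dsimp only
  rw [getM_tabM _ hi hj, sumR_eq_sum]
  refine Finset.sum_congr rfl fun l hl ↦ ?_
  unfold chBlk
  rw [getM_tabM _ hi (Finset.mem_range.1 hl), sumR_eq_sum]

/-- Entries of the materialized `S'`. [folklore] -/
theorem getM_spBlk {i j : ℕ} (hi : i < c.nb) (hj : j < c.nb) :
    getM (c.spBlk nu p) i j =
      (∑ k ∈ range c.nb, getM (c.Db p) k i *
          ∑ l ∈ range c.nb, c.prQ nu (2 * k + p) (2 * l + p) * getM (c.Db p) l j) +
        c.kappaQ nu * ((if i = j then 2 * c.bQ p i else 0) - c.bQ p i * c.bQ p j * getM (c.hpBlk p) i j) := by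
  unfold spBlk
  dsimp only
  rw [getM_tabM _ hi hj, sumR_eq_sum]
  congr 1
  exact Finset.sum_congr rfl fun k hk ↦ by rw [c.getM_pdBlk nu p (Finset.mem_range.1 hk) hj]

/-- Entries of the materialized `R = S' − UᵀU`. [folklore] -/
theorem getM_rBlk {i j : ℕ} (hi : i < c.nb) (hj : j < c.nb) :
    getM (c.rBlk nu p) i j =
      getM (c.spBlk nu p) i j - ∑ k ∈ range c.nb, getM (c.Ub p) k i * getM (c.Ub p) k j := by
  unfold rBlk
  dsimp only
  rw [getM_tabM _ hi hj, sumR_eq_sum]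

/-- `checkDC` certifies `D C = I` on the block. [folklore] -/
theorem of_checkDC (h : c.checkDC p = true) {i j : ℕ} (hi : i < c.nb) (hj : j < c.nb) :
    ∑ k ∈ range c.nb, getM (c.Db p) i k * getM (c.Cb p) k j = if i = j then 1 else 0 := by
  unfold checkDC at h
  have h1 := of_allBelow (of_allBelow h hi) hj
  rw [decide_eq_true_eq, sumR_eq_sum] at h1
  exact h1

/-- `checkDom` certifies diagonal dominance. [folklore] -/
theorem of_checkDom {nb : ℕ} {R : List (List ℚ)} (h : checkDom nb R = true) {i : ℕ} (hi : i < nb) :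
    ∑ j ∈ range nb, (if j = i then 0 else (|getM R i j| + |getM R j i|) / 2) ≤ getM R i i := by
  unfold checkDom at h
  have h1 := of_allBelow h hi
  rw [decide_eq_true_eq, sumR_eq_sum] at h1
  exact h1

end Tables

/-! ### The vectors of the Bessel step -/

/-- `y_p(j) = Σ_{i<nb} C_p[j][i] M(2i+p)` (Legendre-type coordinates of the moments). [folklore] -/
def yVec (M : ℕ → ℂ) (p j : ℕ) : ℂ :=
  ∑ i ∈ range c.nb, (getM (c.Cb p) j i : ℂ) * M (2 * i + p)

/-- `u(2i+p) = Σ_{j<nb} C_p[j][i] b_p(j) y_p(j)` (the test polynomial of the Bessel step). [folklore] -/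
def uVec (M : ℕ → ℂ) (k : ℕ) : ℂ :=
  ∑ j ∈ range c.nb, ((getM (c.Cb (k % 2)) j (k / 2) * c.bQ (k % 2) j : ℚ) : ℂ) * c.yVec M (k % 2) j

variable {c}

/-- `u` on the block `p`. [folklore] -/
theorem uVec_block (M : ℕ → ℂ) (p i : ℕ) (hp : p < 2) :
    c.uVec M (2 * i + p) =
      ∑ j ∈ range c.nb, ((getM (c.Cb p) j i * c.bQ p j : ℚ) : ℂ) * c.yVec M p j := by
  unfold uVec
  have h1 : (2 * i + p) % 2 = p := by omega
  have h2 : (2 * i + p) / 2 = i := by omega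
  rw [h1, h2]

/-- `P_r` vanishes across parities. [folklore] -/
theorem prQ_cross (nu : List ℚ) {k l : ℕ} (h : k % 2 ≠ l % 2) : c.prQ nu k l = 0 := by
  unfold prQ pmQ
  rw [if_neg h]
  unfold ratRd
  simp

/-! ### The algebraic core: per-parity reduction and positivity -/

/-- The real block matrix `S'_p` as a function. [folklore] -/
def spFun (c : WeilCert) (nu : List ℚ) (p : ℕ) (j j' : ℕ) : ℝ := (getM (c.spBlk nu p) j j' : ℝ)

/-- **Block positivity** from the dominance check. [folklore] -/
theorem spFun_quad_nonneg {nu : List ℚ} {p : ℕ} (h : c.checkBlock nu p = true) (x : ℕ → ℝ) :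
    0 ≤ ∑ i ∈ range c.nb, ∑ j ∈ range c.nb, spFun c nu p i j * (x i * x j) := by
  unfold checkBlock at h
  rw [Bool.and_eq_true] at h
  have hdom := h.2
  set R : ℕ → ℕ → ℝ := fun i j ↦ (getM (c.rBlk nu p) i j : ℝ) with hR
  set U : ℕ → ℕ → ℝ := fun i j ↦ (getM (c.Ub p) i j : ℝ) with hU
  have hsplit : ∀ i ∈ range c.nb, ∀ j ∈ range c.nb,
      spFun c nu p i j = R i j + ∑ k ∈ range c.nb, U k i * U k j := by
    intro i hi j hj
    rw [hR, hU, spFun]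
    simp only
    rw [c.getM_rBlk nu p (Finset.mem_range.1 hi) (Finset.mem_range.1 hj)]
    push_cast
    ring
  have h1 : ∑ i ∈ range c.nb, ∑ j ∈ range c.nb, spFun c nu p i j * (x i * x j) =
      ∑ i ∈ range c.nb, ∑ j ∈ range c.nb, R i j * (x i * x j) +
        ∑ i ∈ range c.nb, ∑ j ∈ range c.nb, (∑ k ∈ range c.nb, U k i * U k j) * (x i * x j) := by
    rw [← Finset.sum_add_distrib]
    refine Finset.sum_congr rfl fun i hi ↦ ?_
    rw [← Finset.sum_add_distrib]
    refine Finset.sum_congr rfl fun j hj ↦ ?_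
    rw [hsplit i hi j hj]
    ring
  rw [h1]
  refine add_nonneg (WeilAlg.quad_nonneg_of_dominant c.nb R (fun i hi ↦ ?_) x)
    (WeilAlg.quad_gram_nonneg c.nb U x)
  have hd := of_checkDom hdom (Finset.mem_range.1 hi)
  rw [hR]
  simp only
  have : ∑ j ∈ range c.nb, (if j = i then (0 : ℝ) else
      (|((getM (c.rBlk nu p) i j : ℚ) : ℝ)| + |((getM (c.rBlk nu p) j i : ℚ) : ℝ)|) / 2) =
      ((∑ j ∈ range c.nb, (if j = i then (0 : ℚ) else
        (|getM (c.rBlk nu p) i j| + |getM (c.rBlk nu p) j i|) / 2) : ℚ) : ℝ) := by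
    push_cast
    refine Finset.sum_congr rfl fun j _ ↦ ?_
    split_ifs <;> simp
  rw [this]
  exact_mod_cast hd

/-- **Per-parity identity.** The block contributions equal `Re y* S'_p y`. [folklore] -/
theorem block_identity {nu : List ℚ} {p : ℕ} (hp : p < 2) (hDC : c.checkDC p = true) (M : ℕ → ℂ) :
    (∑ i ∈ range c.nb, ∑ i' ∈ range c.nb,
        (c.prQ nu (2 * i + p) (2 * i' + p) : ℂ) * (conj (M (2 * i + p)) * M (2 * i' + p))) +
      (c.kappaQ nu : ℂ) *
        (2 * ∑ i ∈ range c.nb, conj (c.uVec M (2 * i + p)) * M (2 * i + p) -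
          ∑ i ∈ range c.nb, ∑ i' ∈ range c.nb,
            conj (c.uVec M (2 * i + p)) * c.uVec M (2 * i' + p) * (c.hBlkQ p i i' : ℂ)) =
      ∑ j ∈ range c.nb, ∑ j' ∈ range c.nb,
        (spFun c nu p j j' : ℂ) * (conj (c.yVec M p j) * c.yVec M p j') := by
  set nb := c.nb with hnb
  set y : ℕ → ℂ := c.yVec M p with hy
  set D : ℕ → ℕ → ℝ := fun i j ↦ (getM (c.Db p) i j : ℝ) with hD
  set C : ℕ → ℕ → ℝ := fun i j ↦ (getM (c.Cb p) i j : ℝ) with hC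
  set b : ℕ → ℝ := fun j ↦ (c.bQ p j : ℝ) with hb
  -- (1) retraction: M(2i+p) = Σ_j D i j y j
  have hDC' : ∀ i ∈ range nb, ∀ i' ∈ range nb,
      ∑ j ∈ range nb, (D i j : ℂ) * C j i' = if i = i' then 1 else 0 := by
    intro i hi i' hi'
    have h := c.of_checkDC p hDC (Finset.mem_range.1 hi) (Finset.mem_range.1 hi')
    rw [hD, hC]
    simp only
    have e : ∑ j ∈ range nb, (((getM (c.Db p) i j : ℚ) : ℝ) : ℂ) * (((getM (c.Cb p) j i' : ℚ) : ℝ) : ℂ)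
        = (((∑ j ∈ range c.nb, getM (c.Db p) i j * getM (c.Cb p) j i' : ℚ) : ℝ) : ℂ) := by
      push_cast; rfl
    rw [e, h]
    push_cast
    split_ifs <;> simp
  have hret : ∀ i ∈ range nb, M (2 * i + p) = ∑ j ∈ range nb, (D i j : ℂ) * y j := by
    intro i hi
    rw [hy]
    unfold yVec
    rw [← hnb]
    have := WeilAlg.lin_retract nb D C (fun i' ↦ M (2 * i' + p)) hDC' hi
    rw [hC] at this
    simp only at this
    rw [← this]
    rfl
  -- (2) the `P_r` term
  have hP : ∑ i ∈ range nb, ∑ i' ∈ range nb,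
      (c.prQ nu (2 * i + p) (2 * i' + p) : ℂ) * (conj (M (2 * i + p)) * M (2 * i' + p)) =
      ∑ j ∈ range nb, ∑ j' ∈ range nb,
        (∑ i ∈ range nb, ∑ i' ∈ range nb,
          (D i j : ℂ) * (c.prQ nu (2 * i + p) (2 * i' + p) : ℂ) * D i' j') * (conj (y j) * y j') := by
    rw [← WeilAlg.quad_transform nb nb]
    refine Finset.sum_congr rfl fun i hi ↦ Finset.sum_congr rfl fun i' hi' ↦ ?_
    rw [hret i hi, hret i' hi']
  -- (3) the `u`-terms
  have hu : ∀ i, c.uVec M (2 * i + p) = ∑ j ∈ range nb, ((C j i * b j : ℝ) : ℂ) * y j := by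
    intro i
    rw [uVec_block M p i hp, hC, hb, hy, ← hnb]
    refine Finset.sum_congr rfl fun j _ ↦ ?_
    push_cast
    rfl
  have hu1 : 2 * ∑ i ∈ range nb, conj (c.uVec M (2 * i + p)) * M (2 * i + p) =
      ∑ j ∈ range nb, ∑ j' ∈ range nb,
        ((if j = j' then 2 * b j else 0 : ℝ) : ℂ) * (conj (y j) * y j') := by
    have e1 : ∀ i ∈ range nb, conj (c.uVec M (2 * i + p)) * M (2 * i + p) =
        ∑ j ∈ range nb, (b j : ℂ) * conj (y j) * ((C j i : ℂ) * M (2 * i + p)) := by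
      intro i _
      rw [hu i, map_sum, Finset.sum_mul]
      refine Finset.sum_congr rfl fun j _ ↦ ?_
      rw [map_mul, Complex.conj_ofReal]
      push_cast
      ring
    rw [Finset.sum_congr rfl e1, Finset.sum_comm]
    have e2 : ∀ j ∈ range nb, ∑ i ∈ range nb, (b j : ℂ) * conj (y j) * ((C j i : ℂ) * M (2 * i + p)) =
        (b j : ℂ) * conj (y j) * y j := by
      intro j _
      rw [← Finset.mul_sum]
      congr 1
    rw [Finset.sum_congr rfl e2, Finset.mul_sum]
    refine Finset.sum_congr rfl fun j hj ↦ ?_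
    have e3 : ∀ j' ∈ range nb, ((if j = j' then 2 * b j else 0 : ℝ) : ℂ) * (conj (y j) * y j') =
        if j = j' then (2 * b j : ℂ) * (conj (y j) * y j') else 0 := by
      intro j' _
      split_ifs
      · push_cast; ring
      · simp
    rw [Finset.sum_congr rfl e3, Finset.sum_ite_eq, if_pos hj]
    ring
  have hu2 : ∑ i ∈ range nb, ∑ i' ∈ range nb,
      conj (c.uVec M (2 * i + p)) * c.uVec M (2 * i' + p) * (c.hBlkQ p i i' : ℂ) =
      ∑ j ∈ range nb, ∑ j' ∈ range nb,
        (∑ i ∈ range nb, ∑ i' ∈ range nb,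
          ((C j i * b j : ℝ) : ℂ) * (c.hBlkQ p i i' : ℂ) * ((C j' i' * b j' : ℝ) : ℂ)) *
          (conj (y j) * y j') := by
    rw [← WeilAlg.quad_transform nb nb (fun i i' ↦ (c.hBlkQ p i i' : ℂ)) (fun i j ↦ C j i * b j) y]
    refine Finset.sum_congr rfl fun i _ ↦ Finset.sum_congr rfl fun i' _ ↦ ?_
    rw [hu i, hu i']
    ring
  rw [hP, hu1, hu2, mul_sub, Finset.mul_sum, Finset.mul_sum, ← Finset.sum_sub_distrib,
    ← Finset.sum_add_distrib]
  refine Finset.sum_congr rfl fun j hj ↦ ?_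
  rw [Finset.mul_sum, Finset.mul_sum, ← Finset.sum_sub_distrib, ← Finset.sum_add_distrib]
  refine Finset.sum_congr rfl fun j' hj' ↦ ?_
  -- entry identity
  have hS := c.getM_spBlk nu p (Finset.mem_range.1 hj) (Finset.mem_range.1 hj')
  have hH := c.getM_hpBlk p (Finset.mem_range.1 hj) (Finset.mem_range.1 hj')
  rw [spFun, hS]
  have eP : ∑ i ∈ range nb, ∑ i' ∈ range nb,
      (D i j : ℂ) * (c.prQ nu (2 * i + p) (2 * i' + p) : ℂ) * D i' j' =
      (((∑ k ∈ range c.nb, getM (c.Db p) k j *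
        ∑ l ∈ range c.nb, c.prQ nu (2 * k + p) (2 * l + p) * getM (c.Db p) l j' : ℚ) : ℝ) : ℂ) := by
    rw [hD]
    push_cast
    rw [← hnb]
    refine Finset.sum_congr rfl fun i _ ↦ ?_
    rw [Finset.mul_sum]
    refine Finset.sum_congr rfl fun i' _ ↦ ?_
    ring
  have eH : ∑ i ∈ range nb, ∑ i' ∈ range nb,
      ((C j i * b j : ℝ) : ℂ) * (c.hBlkQ p i i' : ℂ) * ((C j' i' * b j' : ℝ) : ℂ) =
      (b j : ℂ) * b j' * (((getM (c.hpBlk p) j j' : ℚ) : ℝ) : ℂ) := by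
    rw [hH, hC, hb]
    push_cast
    rw [← hnb, Finset.mul_sum, Finset.sum_comm]
    refine Finset.sum_congr rfl fun i' _ ↦ ?_
    rw [Finset.sum_mul, Finset.mul_sum]
    refine Finset.sum_congr rfl fun i _ ↦ ?_
    ring
  rw [eP, eH, hb]
  split_ifs <;> push_cast <;> ring

/-- **The algebraic core.** With `N + 1 = 2 nb`, both blocks checked and `κ ≥ 0`... (κ sign not
needed here): the reduced form plus `κ ×` the Bessel expression is `Σ_p Re y_p* S'_p y_p ≥ 0`. [folklore] -/
theorem core_nonneg {nu : List ℚ} (hN : c.N + 1 = 2 * c.nb) (hb0 : c.checkBlock nu 0 = true)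
    (hb1 : c.checkBlock nu 1 = true) (a : ℝ) (ha : (c.a0 : ℝ) = a) (M : ℕ → ℂ) :
    0 ≤ (∑ k ∈ range (c.N + 1), ∑ l ∈ range (c.N + 1),
        (c.prQ nu k l : ℝ) * (conj (M k) * M l).re) +
      (c.kappaQ nu : ℝ) *
        (2 * (∑ k ∈ range (c.N + 1), conj (c.uVec M k) * M k).re -
          (∑ k ∈ range (c.N + 1), ∑ l ∈ range (c.N + 1),
            conj (c.uVec M k) * c.uVec M l * (gramH a k l : ℂ)).re) := by
  have hDC0 : c.checkDC 0 = true := by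
    unfold checkBlock at hb0; rw [Bool.and_eq_true] at hb0; exact hb0.1
  have hDC1 : c.checkDC 1 = true := by
    unfold checkBlock at hb1; rw [Bool.and_eq_true] at hb1; exact hb1.1
  -- rewrite everything as the real part of one complex expression
  have key : (∑ k ∈ range (c.N + 1), ∑ l ∈ range (c.N + 1),
        (c.prQ nu k l : ℝ) * (conj (M k) * M l).re) +
      (c.kappaQ nu : ℝ) *
        (2 * (∑ k ∈ range (c.N + 1), conj (c.uVec M k) * M k).re -
          (∑ k ∈ range (c.N + 1), ∑ l ∈ range (c.N + 1),
            conj (c.uVec M k) * c.uVec M l * (gramH a k l : ℂ)).re) =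
      ((∑ k ∈ range (c.N + 1), ∑ l ∈ range (c.N + 1),
          (c.prQ nu k l : ℂ) * (conj (M k) * M l)) +
        (c.kappaQ nu : ℂ) *
          (2 * ∑ k ∈ range (c.N + 1), conj (c.uVec M k) * M k -
            ∑ k ∈ range (c.N + 1), ∑ l ∈ range (c.N + 1),
              conj (c.uVec M k) * c.uVec M l * (gramH a k l : ℂ))).re := by
    have e1 : (∑ k ∈ range (c.N + 1), ∑ l ∈ range (c.N + 1),
        (c.prQ nu k l : ℂ) * (conj (M k) * M l)).re =
        ∑ k ∈ range (c.N + 1), ∑ l ∈ range (c.N + 1), (c.prQ nu k l : ℝ) * (conj (M k) * M l).re := by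
      rw [Complex.re_sum]
      refine Finset.sum_congr rfl fun k _ ↦ ?_
      rw [Complex.re_sum]
      refine Finset.sum_congr rfl fun l _ ↦ ?_
      rw [show ((c.prQ nu k l : ℚ) : ℂ) = (((c.prQ nu k l : ℚ) : ℝ) : ℂ) by norm_cast,
        Complex.re_ofReal_mul]
    have e2 : ∀ (κ : ℚ) (X Y : ℂ), ((κ : ℂ) * (2 * X - Y)).re = (κ : ℝ) * (2 * X.re - Y.re) := by
      intro κ X Y
      rw [show ((κ : ℚ) : ℂ) = (((κ : ℚ) : ℝ) : ℂ) by norm_cast, Complex.re_ofReal_mul]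
      congr 1
      simp [Complex.mul_re]
    rw [Complex.add_re, e1, e2]
  rw [key]
  -- parity split
  have hH : ∀ k l, k % 2 ≠ l % 2 → (gramH a k l : ℂ) = 0 := by
    intro k l hkl
    have hodd : Odd (k + l) := by
      rcases Nat.even_or_odd k with hk | hk <;> rcases Nat.even_or_odd l with hl | hl
      · exact absurd (by rw [Nat.even_iff.1 hk, Nat.even_iff.1 hl]) hkl
      · exact hk.add_odd hl
      · exact hk.add_even hl
      · exact absurd (by rw [Nat.odd_iff.1 hk, Nat.odd_iff.1 hl]) hkl
    rw [gramH, hodd.neg_one_pow]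
    simp
  rw [hN, WeilAlg.sum_sum_range_two_mul c.nb _ (fun k l hkl ↦ by
      rw [c.prQ_cross nu hkl]; simp),
    WeilAlg.sum_range_two_mul c.nb,
    WeilAlg.sum_sum_range_two_mul c.nb _ (fun k l hkl ↦ by rw [hH k l hkl]; simp)]
  -- the Gram entries on the blocks
  have hG : ∀ p i i', p < 2 → (gramH a (2 * i + p) (2 * i' + p) : ℂ) = (c.hBlkQ p i i' : ℂ) := by
    intro p i i' hp
    have hev : Even (2 * i + p + (2 * i' + p)) := ⟨i + i' + p, by ring⟩
    rw [gramH, hev.neg_one_pow, hBlkQ, ← ha]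
    push_cast
    ring
  have e0 := c.block_identity (nu := nu) (p := 0) (by norm_num) hDC0 M
  have e1 := c.block_identity (nu := nu) (p := 1) (by norm_num) hDC1 M
  simp only [add_zero] at e0
  have hG0 : ∀ i i', (gramH a (2 * i) (2 * i') : ℂ) = (c.hBlkQ 0 i i' : ℂ) := fun i i' ↦ by
    simpa using hG 0 i i' (by norm_num)
  have hG1 : ∀ i i', (gramH a (2 * i + 1) (2 * i' + 1) : ℂ) = (c.hBlkQ 1 i i' : ℂ) := fun i i' ↦
    hG 1 i i' (by norm_num)
  simp_rw [hG0, hG1]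
  have etot : (∑ i ∈ range c.nb, ∑ j ∈ range c.nb,
        (c.prQ nu (2 * i) (2 * j) : ℂ) * (conj (M (2 * i)) * M (2 * j)) +
      ∑ i ∈ range c.nb, ∑ j ∈ range c.nb,
        (c.prQ nu (2 * i + 1) (2 * j + 1) : ℂ) * (conj (M (2 * i + 1)) * M (2 * j + 1))) +
      (c.kappaQ nu : ℂ) *
        (2 * (∑ i ∈ range c.nb, conj (c.uVec M (2 * i)) * M (2 * i) +
            ∑ i ∈ range c.nb, conj (c.uVec M (2 * i + 1)) * M (2 * i + 1)) -
          (∑ i ∈ range c.nb, ∑ j ∈ range c.nb,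
              conj (c.uVec M (2 * i)) * c.uVec M (2 * j) * (c.hBlkQ 0 i j : ℂ) +
            ∑ i ∈ range c.nb, ∑ j ∈ range c.nb,
              conj (c.uVec M (2 * i + 1)) * c.uVec M (2 * j + 1) * (c.hBlkQ 1 i j : ℂ))) =
      (∑ j ∈ range c.nb, ∑ j' ∈ range c.nb,
        (spFun c nu 0 j j' : ℂ) * (conj (c.yVec M 0 j) * c.yVec M 0 j')) +
      ∑ j ∈ range c.nb, ∑ j' ∈ range c.nb,
        (spFun c nu 1 j j' : ℂ) * (conj (c.yVec M 1 j) * c.yVec M 1 j') := by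
    rw [← e0, ← e1]
    ring
  rw [etot, Complex.add_re]
  exact add_nonneg
    (WeilAlg.re_herm_nonneg c.nb _ (fun x ↦ c.spFun_quad_nonneg hb0 x) _)
    (WeilAlg.re_herm_nonneg c.nb _ (fun x ↦ c.spFun_quad_nonneg hb1 x) _)

end WeilCert




/-! ### Small facts about the constants and the rounding -/

/-- `x < rd(x) + 2^{-p}`. [folklore] -/
theorem lt_ratRd_add (p : ℕ) (x : ℚ) : x < ratRd p x + 1 / 2 ^ p := by
  unfold ratRd
  have := Int.lt_floor_add_one (x * 2 ^ p)
  have hp : (0 : ℚ) < 2 ^ p := by positivity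
  rw [show ((⌊x * 2 ^ p⌋ : ℤ) : ℚ) / 2 ^ p + 1 / 2 ^ p = (((⌊x * 2 ^ p⌋ : ℤ) : ℚ) + 1) / 2 ^ p by ring,
    lt_div_iff₀ hp]
  exact this

/-- `|x − rd(x)| ≤ 2^{-p}` (real form). [folklore] -/
theorem abs_cast_sub_ratRd_le (p : ℕ) (x : ℚ) :
    |((x : ℚ) : ℝ) - ((ratRd p x : ℚ) : ℝ)| ≤ 1 / 2 ^ p := by
  have h1 : ((ratRd p x : ℚ) : ℝ) ≤ x := by exact_mod_cast ratRd_le p x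
  have h2 : ((x : ℚ) : ℝ) < ((ratRd p x + 1 / 2 ^ p : ℚ) : ℝ) := by exact_mod_cast lt_ratRd_add p x
  push_cast at h2
  rw [abs_of_nonneg (by linarith)]
  linarith

/-- `log π ≤ logPiHi`. [folklore] -/
theorem logPiHi_ge : Real.log π ≤ ((logPiHi : ℚ) : ℝ) := by
  have h := Literature.Analysis.SpecialFunctions.Real.log_pi_le
  have e : ((logPiHi : ℚ) : ℝ) = 1.1447299 := by unfold logPiHi; push_cast; norm_num
  rw [e]; exact h

/-- `1/(2π) ≤ invTwoPiHi`. [folklore] -/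
theorem invTwoPiHi_ge : 1 / (2 * π) ≤ ((invTwoPiHi : ℚ) : ℝ) := by
  have h := Real.pi_gt_d6
  have e : ((invTwoPiHi : ℚ) : ℝ) = 1 / (2 * 3.141592) := by
    unfold invTwoPiHi piLo; push_cast; norm_num
  rw [e]
  exact one_div_le_one_div_of_le (by norm_num) (by linarith)

/-- `0 ≤ invTwoPiHi`. [folklore] -/
theorem invTwoPiHi_nonneg : (0 : ℝ) ≤ ((invTwoPiHi : ℚ) : ℝ) :=
  le_trans (by positivity) invTwoPiHi_ge

/-- `logTwoHi ≤ 2a₀ → (log 2)/2 ≤ a₀`. [folklore] -/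
theorem log_two_half_le_of_check {a0 : ℚ} (h : logTwoHi ≤ 2 * a0) : Real.log 2 / 2 ≤ (a0 : ℝ) := by
  have h2 := Real.log_two_lt_d9
  have e : ((logTwoHi : ℚ) : ℝ) = 0.6931471808 := by unfold logTwoHi; push_cast; norm_num
  have h' : ((logTwoHi : ℚ) : ℝ) ≤ 2 * (a0 : ℝ) := by exact_mod_cast h
  rw [e] at h'
  linarith

namespace WeilCert

variable {c : WeilCert}

/-- Unpacking `check`. [folklore] -/
theorem check_spec (h : c.check = true) :
    checkCells c.prec c.wL c.T c.mwT c.cells = true ∧ c.checkScalars c.nuTab = true ∧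
      c.checkBlock c.nuTab 0 = true ∧ c.checkBlock c.nuTab 1 = true := by
  unfold check at h
  simp only [Bool.and_eq_true] at h
  exact ⟨h.1.1.1, h.1.1.2, h.1.2, h.2⟩

/-- Unpacking `checkScalars`. [folklore] -/
theorem scalars_spec {nu : List ℚ} (h : c.checkScalars nu = true) :
    logTwoHi ≤ 2 * c.a0 ∧ c.a0 ≤ 1 ∧ 0 < c.T ∧ 2 * c.a0 * c.T ≤ (c.N : ℚ) + 2 ∧
      2 * (c.a0 * c.T) ^ (c.N + 1) / (c.N + 1).factorial ≤ 1 ∧ c.N + 1 = 2 * c.nb ∧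
      0 ≤ c.kappaQ nu := by
  unfold checkScalars at h
  simp only [Bool.and_eq_true, decide_eq_true_eq] at h
  exact ⟨h.1.1.1.1.1.1, h.1.1.1.1.1.2, h.1.1.1.1.2, h.1.1.1.2, h.1.1.2, h.1.2, h.2⟩

/-- The table of moments agrees with `nuQ` up to `2N`. [folklore] -/
theorem getV_nuTab {q : ℕ} (hq : q ≤ 2 * c.N) : getV c.nuTab q = c.nuQ q := by
  unfold nuTab; exact getV_tabV _ (by omega)

/-- Cast of `tauQ`. [folklore] -/
theorem tauQ_cast (d : ℕ) : ((c.tauQ d : ℚ) : ℝ) = ((c.a0 : ℝ) / 2) ^ d / d.factorial := by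
  unfold tauQ; push_cast; ring

/-! ### Moments of the minorant, all parities -/

/-- `γ` is even. [folklore] -/
theorem cellsGamma_neg (wL : ℚ) (cells : List WeilCell) (t : ℝ) :
    cellsGamma wL cells (-t) = cellsGamma wL cells t := by
  unfold cellsGamma; rw [abs_neg]

/-- `∫ γ(t) t^q dt = 2 Σ_j momentQ_j(q)` for even `q`, `= 0` for odd `q`; and integrability. [folklore] -/
theorem integral_gamma_pow (hcells : checkCells c.prec c.wL c.T c.mwT c.cells = true) (q : ℕ) :
    Integrable (fun t ↦ cellsGamma c.wL c.cells t * t ^ q) ∧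
      ∫ t, cellsGamma c.wL c.cells t * t ^ q =
        if Even q then 2 * (cellsMomentQ c.wL c.cells q : ℝ) else 0 := by
  rcases Nat.even_or_odd q with hq | hq
  · rw [if_pos hq]; exact integral_cellsGamma_mul_pow hcells hq
  · rw [if_neg (Nat.not_even_iff_odd.2 hq)]
    have h0 := (integral_cellsGamma_mul_pow hcells (Even.zero)).1
    have h1 := (integral_cellsGamma_mul_pow hcells (hq.add_one)).1
    simp only [pow_zero, mul_one] at h0
    have hγ0 := cellsGamma_nonneg hcells
    have hint : Integrable (fun t ↦ cellsGamma c.wL c.cells t * t ^ q) := by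
      refine Integrable.mono' (h0.add h1)
        (((measurable_cellsGamma _ _).mul (measurable_id.pow_const q)).aestronglyMeasurable)
        (Eventually.of_forall fun t ↦ ?_)
      rw [Real.norm_eq_abs, abs_mul, abs_of_nonneg (hγ0 t)]
      simp only [Pi.add_apply]
      rw [show cellsGamma c.wL c.cells t + cellsGamma c.wL c.cells t * t ^ (q + 1) =
        cellsGamma c.wL c.cells t * (1 + t ^ (q + 1)) by ring]
      refine mul_le_mul_of_nonneg_left ?_ (hγ0 t)
      rw [abs_pow]
      rcases le_or_gt |t| 1 with ht | ht
      · have : |t| ^ q ≤ 1 := pow_le_one₀ (abs_nonneg t) ht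
        have : 0 ≤ t ^ (q + 1) := by rw [← (hq.add_one).pow_abs]; positivity
        linarith
      · have : |t| ^ q ≤ |t| ^ (q + 1) := pow_le_pow_right₀ ht.le (Nat.le_succ q)
        rw [(hq.add_one).pow_abs] at this
        linarith
    refine ⟨hint, ?_⟩
    have hodd : ∀ t, cellsGamma c.wL c.cells (-t) * (-t) ^ q = -(cellsGamma c.wL c.cells t * t ^ q) := by
      intro t; rw [cellsGamma_neg, hq.neg_pow]; ring
    have h := integral_neg_eq_self (fun t ↦ cellsGamma c.wL c.cells t * t ^ q) volume
    simp_rw [hodd] at h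
    rw [integral_neg] at h
    linarith

/-- `ν_q = a₀^q ∫ γ(t) t^q dt` for even `q`. [folklore] -/
theorem nuQ_eq_integral (hcells : checkCells c.prec c.wL c.T c.mwT c.cells = true) {q : ℕ}
    (hq : Even q) :
    ((c.nuQ q : ℚ) : ℝ) = (c.a0 : ℝ) ^ q * ∫ t, cellsGamma c.wL c.cells t * t ^ q := by
  rw [(integral_gamma_pow hcells q).2, if_pos hq]
  unfold nuQ; push_cast; ring

/-- `ν_q ≥ 0` for even `q`. [folklore] -/
theorem nuQ_nonneg (hcells : checkCells c.prec c.wL c.T c.mwT c.cells = true) (ha : 0 ≤ c.a0)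
    {q : ℕ} (hq : Even q) : (0 : ℝ) ≤ ((c.nuQ q : ℚ) : ℝ) := by
  rw [nuQ_eq_integral hcells hq]
  refine mul_nonneg (pow_nonneg (by exact_mod_cast ha) _) (integral_nonneg fun t ↦ ?_)
  have : 0 ≤ t ^ q := by rw [← hq.pow_abs]; positivity
  exact mul_nonneg (cellsGamma_nonneg hcells t) this

/-! ### Step C: the frequency side -/

variable {g : ℝ → ℂ}

/-- The matrix `Ĝ` of the frequency side. [folklore] -/
def gHat (c : WeilCert) (k l : ℕ) : ℝ :=
  if k % 2 = l % 2 then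
    (-1 : ℝ) ^ k * (-1) ^ ((k + l) / 2) * ((c.nuQ (k + l) : ℚ) : ℝ) / (k.factorial * l.factorial)
  else 0

/-- `k ≡ l (mod 2) ↔ k + l` even. [folklore] -/
theorem mod_two_eq_iff_even (k l : ℕ) : k % 2 = l % 2 ↔ Even (k + l) := by
  rw [Nat.even_add, Nat.even_iff, Nat.even_iff]; omega

/-- **Frequency bound.** `∫ ‖ĝ(1/2+it)‖² γ(t) dt ≤ Σ Ĝ_{kl} Re(conj M_k M_l) + 5 ‖g‖₁² ν'`. [folklore] -/
theorem freq_integral_bound (hcells : checkCells c.prec c.wL c.T c.mwT c.cells = true)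
    (hsc : c.checkScalars c.nuTab = true) (hg : IsWeilTest g)
    (hsupp : tsupport g ⊆ Icc (-(c.a0 : ℝ)) c.a0) :
    ∫ t : ℝ, ‖weilMellin g (1 / 2 + t * I)‖ ^ 2 * cellsGamma c.wL c.cells t ≤
      ∑ k ∈ range (c.N + 1), ∑ l ∈ range (c.N + 1),
          gHat c k l * (conj (weilMoment c.a0 g k) * weilMoment c.a0 g l).re +
        5 * weilNorm1 g ^ 2 * ((c.nuPrime c.nuTab : ℚ) : ℝ) := by
  obtain ⟨h2a, ha1, hT, haT, hρT, hN, -⟩ := scalars_spec hsc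
  set a : ℝ := (c.a0 : ℝ) with ha_def
  have ha : 0 < a := by
    have := log_two_half_le_of_check h2a
    have h2 : 0 < Real.log 2 := Real.log_pos one_lt_two
    rw [ha_def]; linarith
  set γ : ℝ → ℝ := cellsGamma c.wL c.cells with hγ
  set M : ℕ → ℂ := weilMoment a g with hM
  set n := c.N + 1 with hn
  set L := weilNorm1 g with hL
  have hn_even : Even n := ⟨c.nb, by omega⟩
  -- the pointwise bound, valid for all t (both sides vanish for |t| ≥ T)
  set W : ℕ → ℕ → ℝ := fun k l ↦
    (((-1 : ℂ) ^ k * I ^ (k + l)) * (conj (M k) * M l)).re with hW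
  have hpt : ∀ t : ℝ, ‖weilMellin g (1 / 2 + t * I)‖ ^ 2 * γ t ≤
      (∑ k ∈ range n, ∑ l ∈ range n,
        W k l * (a ^ (k + l) / (k.factorial * l.factorial)) * (γ t * t ^ (k + l))) +
        5 * L ^ 2 * (2 * a ^ n / n.factorial) * (γ t * t ^ n) := by
    intro t
    have hγ0 : 0 ≤ γ t := cellsGamma_nonneg hcells t
    rcases lt_or_ge |t| (c.T : ℝ) with ht | ht
    · have ht1 : 2 * a * |t| ≤ c.N + 2 := by
        have h1 : 2 * a * |t| ≤ 2 * a * c.T := by nlinarith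
        have h2 : (2 * c.a0 * c.T : ℝ) ≤ c.N + 2 := by exact_mod_cast haT
        rw [ha_def] at h1 ⊢; linarith
      have ht2 : 2 * (|t| * a) ^ (c.N + 1) / (c.N + 1).factorial ≤ 1 := by
        have h1 : (|t| * a) ^ (c.N + 1) ≤ (c.T * a) ^ (c.N + 1) :=
          pow_le_pow_left₀ (by positivity) (by nlinarith) _
        have h2 : (2 * (c.a0 * c.T) ^ (c.N + 1) / (c.N + 1).factorial : ℝ) ≤ 1 := by
          exact_mod_cast hρT
        rw [ha_def] at h1 ⊢
        rw [mul_comm (c.a0 : ℝ)] at h2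
        have h3 : 2 * (|t| * ↑c.a0) ^ (c.N + 1) / ((c.N + 1).factorial : ℝ) ≤
            2 * (↑c.T * ↑c.a0) ^ (c.N + 1) / ((c.N + 1).factorial : ℝ) := by
          gcongr
        linarith
      have h := WeilAna.freq_pointwise_bound hg ha hsupp c.N ht1 ht2
      have h' := mul_le_mul_of_nonneg_right h hγ0
      refine h'.trans (le_of_eq ?_)
      rw [add_mul, Finset.sum_mul]
      congr 1
      · refine Finset.sum_congr rfl fun k _ ↦ ?_
        rw [Finset.sum_mul]
        refine Finset.sum_congr rfl fun l _ ↦ ?_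
        rw [hW, mul_pow]
        simp only
        ring
      · rw [← hn_even.pow_abs t, hn, hL, mul_pow]
        ring
    · have h0 : γ t = 0 := cellsGamma_eq_zero hcells ht
      rw [h0]
      simp
  -- integrability of all terms
  obtain ⟨B, hB0, hB⟩ := exists_abs_cellsGamma_le c.wL c.cells
  have hiL : Integrable fun t : ℝ ↦ ‖weilMellin g (1 / 2 + t * I)‖ ^ 2 * γ t :=
    integrable_norm_sq_weilMellin_mul hg (measurable_cellsGamma _ _) hB0 le_rfl (B := 0)
      (fun t ↦ by simpa using hB t)
  have hiq : ∀ q, Integrable fun t ↦ γ t * t ^ q := fun q ↦ (integral_gamma_pow hcells q).1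
  have hiR : Integrable fun t ↦ (∑ k ∈ range n, ∑ l ∈ range n,
      W k l * (a ^ (k + l) / (k.factorial * l.factorial)) * (γ t * t ^ (k + l))) +
      5 * L ^ 2 * (2 * a ^ n / n.factorial) * (γ t * t ^ n) := by
    refine Integrable.add (integrable_finsetSum _ fun k _ ↦ integrable_finsetSum _ fun l _ ↦
      (hiq (k + l)).const_mul _) ((hiq n).const_mul _)
  have hint := integral_mono hiL hiR hpt
  refine hint.trans (le_of_eq ?_)
  rw [integral_add (integrable_finsetSum _ fun k _ ↦ integrable_finsetSum _ fun l _ ↦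
      (hiq (k + l)).const_mul _) ((hiq n).const_mul _),
    integral_finsetSum _ fun k _ ↦ integrable_finsetSum _ fun l _ ↦ (hiq (k + l)).const_mul _]
  congr 1
  · refine Finset.sum_congr rfl fun k _ ↦ ?_
    rw [integral_finsetSum _ fun l _ ↦ (hiq (k + l)).const_mul _]
    refine Finset.sum_congr rfl fun l _ ↦ ?_
    rw [integral_const_mul, (integral_gamma_pow hcells (k + l)).2, gHat]
    by_cases hkl : k % 2 = l % 2
    · have hev : Even (k + l) := (mod_two_eq_iff_even k l).1 hkl
      rw [if_pos hkl, if_pos hev, hW]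
      simp only
      rw [WeilAna.I_pow_even hev,
        show ((-1 : ℂ) ^ k * (-1) ^ ((k + l) / 2)) * (conj (M k) * M l) =
          (((-1 : ℝ) ^ k * (-1) ^ ((k + l) / 2) : ℝ) : ℂ) * (conj (M k) * M l) by push_cast; ring,
        Complex.re_ofReal_mul]
      unfold nuQ
      push_cast
      rw [hM, ha_def]
      ring
    · have hodd : ¬ Even (k + l) := fun h ↦ hkl ((mod_two_eq_iff_even k l).2 h)
      rw [if_neg hkl, if_neg hodd]
      simp
  · rw [integral_const_mul, (integral_gamma_pow hcells n).2, if_pos hn_even]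
    unfold nuPrime
    rw [getV_nuTab (by omega)]
    unfold nuQ
    push_cast
    rw [hn, ha_def]
    ring

/-! ### Step B: the minorant -/

/-- **Minorant bound.** `wL · 2π ‖g‖₂² − ∫ ‖ĝ‖² γ ≤ ∫ ‖ĝ(1/2+it)‖² Re ψ(1/4+it/2) dt`. [folklore] -/
theorem arch_lower_bound (hcells : checkCells c.prec c.wL c.T c.mwT c.cells = true)
    (hg : IsWeilTest g) :
    (c.wL : ℝ) * (2 * π * weilNorm2Sq g) -
        ∫ t : ℝ, ‖weilMellin g (1 / 2 + t * I)‖ ^ 2 * cellsGamma c.wL c.cells t ≤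
      ∫ t : ℝ, ‖weilMellin g (1 / 2 + t * I)‖ ^ 2 * Literature.Analysis.SpecialFunctions.reDigammaQuarter t := by
  obtain ⟨B, hB0, hB⟩ := exists_abs_cellsGamma_le c.wL c.cells
  set σ : ℝ → ℝ := fun t ↦ (c.wL : ℝ) - cellsGamma c.wL c.cells t with hσ
  have hσm : Measurable σ := measurable_const.sub (measurable_cellsGamma _ _)
  have hσb : ∀ t, |σ t| ≤ (|(c.wL : ℝ)| + B) + 0 * t ^ 2 := fun t ↦ by
    rw [hσ, zero_mul, add_zero]
    exact (abs_sub _ _).trans (add_le_add le_rfl (hB t))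
  have hle : ∀ t, σ t ≤ Literature.Analysis.SpecialFunctions.reDigammaQuarter t := fun t ↦ level_sub_cellsGamma_le hcells t
  have h := integral_norm_sq_weilMellin_mul_mono hg hσm (by positivity) le_rfl hσb hle
  refine le_trans (le_of_eq ?_) h
  have hi1 := integrable_norm_sq_weilMellin_half_line hg
  have hi2 : Integrable fun t : ℝ ↦ ‖weilMellin g (1 / 2 + t * I)‖ ^ 2 * cellsGamma c.wL c.cells t :=
    integrable_norm_sq_weilMellin_mul hg (measurable_cellsGamma _ _) hB0 le_rfl (B := 0)
      (fun t ↦ by simpa using hB t)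
  have e : (fun t : ℝ ↦ ‖weilMellin g (1 / 2 + t * I)‖ ^ 2 * σ t) = fun t : ℝ ↦
      (c.wL : ℝ) * ‖weilMellin g (1 / 2 + t * I)‖ ^ 2 -
        ‖weilMellin g (1 / 2 + t * I)‖ ^ 2 * cellsGamma c.wL c.cells t := by
    funext t; rw [hσ]; ring
  rw [e, integral_sub (hi1.const_mul _) hi2, integral_const_mul,
    integral_norm_sq_weilMellin_half_line hg]

/-! ### The symmetrisation of the polar coefficients -/

/-- Symmetrisation of the polar coefficients: `Σ 2τ₀(k)τ₁(l) z_{kl} = Σ Sym_{kl} z_{kl}` for symmetric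
`z`, `Sym_{kl} = ((−1)^k + (−1)^l) τ(k)τ(l)`. [folklore] -/
theorem polar_symmetrize (n : ℕ) (a : ℝ) (z : ℕ → ℕ → ℝ) (hz : ∀ k l, z k l = z l k) :
    ∑ k ∈ range n, ∑ l ∈ range n,
        (2 * ((-a / 2) ^ k / k.factorial) * ((a / 2) ^ l / l.factorial)) * z k l =
      ∑ k ∈ range n, ∑ l ∈ range n,
        (if k % 2 = l % 2 then
          (-1 : ℝ) ^ k * 2 * ((a / 2) ^ k / k.factorial) * ((a / 2) ^ l / l.factorial) else 0) * z k l := by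
  have hneg : ∀ k : ℕ, (-a / 2) ^ k = (-1) ^ k * (a / 2) ^ k := fun k ↦ by
    rw [show -a / 2 = (-1) * (a / 2) by ring, mul_pow]
  -- split `2 = 1 + 1` and symmetrise the second copy
  have hsplit : ∑ k ∈ range n, ∑ l ∈ range n,
      (2 * ((-a / 2) ^ k / k.factorial) * ((a / 2) ^ l / l.factorial)) * z k l =
      ∑ k ∈ range n, ∑ l ∈ range n,
        (((-a / 2) ^ k / k.factorial) * ((a / 2) ^ l / l.factorial) +
          ((-a / 2) ^ l / l.factorial) * ((a / 2) ^ k / k.factorial)) * z k l := by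
    have hsym : ∑ k ∈ range n, ∑ l ∈ range n, ((-a / 2) ^ k / k.factorial) * ((a / 2) ^ l / l.factorial) * z k l
        = ∑ k ∈ range n, ∑ l ∈ range n, ((-a / 2) ^ l / l.factorial) * ((a / 2) ^ k / k.factorial) * z k l := by
      rw [Finset.sum_comm]
      refine Finset.sum_congr rfl fun k _ ↦ Finset.sum_congr rfl fun l _ ↦ ?_
      rw [hz l k]
    have : ∀ k l, (2 * ((-a / 2) ^ k / k.factorial) * ((a / 2) ^ l / l.factorial)) * z k l =
        ((-a / 2) ^ k / k.factorial) * ((a / 2) ^ l / l.factorial) * z k l +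
          ((-a / 2) ^ k / k.factorial) * ((a / 2) ^ l / l.factorial) * z k l := fun k l ↦ by ring
    simp_rw [this, Finset.sum_add_distrib]
    nth_rw 2 [hsym]
    rw [← Finset.sum_add_distrib]
    refine Finset.sum_congr rfl fun k _ ↦ ?_
    rw [← Finset.sum_add_distrib]
    refine Finset.sum_congr rfl fun l _ ↦ ?_
    ring
  rw [hsplit]
  refine Finset.sum_congr rfl fun k _ ↦ Finset.sum_congr rfl fun l _ ↦ ?_
  congr 1
  rw [hneg k, hneg l]
  by_cases hkl : k % 2 = l % 2
  · rw [if_pos hkl]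
    have : (-1 : ℝ) ^ l = (-1) ^ k := by
      rw [neg_one_pow_eq_pow_mod_two (R := ℝ), ← hkl, ← neg_one_pow_eq_pow_mod_two]
    rw [this]; ring
  · rw [if_neg hkl]
    have : (-1 : ℝ) ^ l = -(-1) ^ k := by
      rcases Nat.even_or_odd k with hk | hk
      · have hl : Odd l := by
          rcases Nat.even_or_odd l with hl | hl
          · exact absurd (by rw [Nat.even_iff.1 hk, Nat.even_iff.1 hl]) hkl
          · exact hl
        rw [hk.neg_one_pow, hl.neg_one_pow]
      · have hl : Even l := by
          rcases Nat.even_or_odd l with hl | hl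
          · exact hl
          · exact absurd (by rw [Nat.odd_iff.1 hk, Nat.odd_iff.1 hl]) hkl
        rw [hk.neg_one_pow, hl.neg_one_pow]; ring
    rw [this]; ring

/-- Entry identity: `(pmQ k l : ℝ) = Sym_{kl} − q Ĝ_{kl}` for `k, l ≤ N`. [folklore] -/
theorem pmQ_cast {k l : ℕ} (hk : k < c.N + 1) (hl : l < c.N + 1) :
    ((c.pmQ c.nuTab k l : ℚ) : ℝ) =
      (if k % 2 = l % 2 then
        (-1 : ℝ) ^ k * 2 * (((c.a0 : ℝ) / 2) ^ k / k.factorial) * (((c.a0 : ℝ) / 2) ^ l / l.factorial)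
        else 0) -
      ((invTwoPiHi : ℚ) : ℝ) * gHat c k l := by
  unfold pmQ gHat
  by_cases hkl : k % 2 = l % 2
  · rw [if_pos hkl, if_pos hkl, if_pos hkl, getV_nuTab (by omega)]
    push_cast
    rw [tauQ_cast, tauQ_cast]
  · rw [if_neg hkl, if_neg hkl, if_neg hkl]
    all_goals simp

/-! ### The main theorem -/

/-- **Soundness of the certificate.** If `c.check = true` then Yoshida's analytic form is
non-negative on `C(a₀) ⊇ C((log 2)/2)`: `0 ≤ E(g)` for every test function `g` with
`tsupport g ⊆ [-(log 2)/2, (log 2)/2]`. [folklore] -/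
theorem weilArchQuadratic_nonneg_of_check (h : c.check = true) {g : ℝ → ℂ} (hg : IsWeilTest g)
    (hsupp : tsupport g ⊆ Icc (-(Real.log 2 / 2)) (Real.log 2 / 2)) :
    0 ≤ weilArchQuadratic g := by
  obtain ⟨hcells, hsc, hb0, hb1⟩ := check_spec h
  obtain ⟨h2a, ha1q, hT, haT, hρT, hN, hκ⟩ := scalars_spec hsc
  set a : ℝ := (c.a0 : ℝ) with ha_def
  have hlog : Real.log 2 / 2 ≤ a := log_two_half_le_of_check h2a
  have ha : 0 < a := lt_of_lt_of_le (by have := Real.log_pos one_lt_two; positivity) hlog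
  have ha1 : a ≤ 1 := by rw [ha_def]; exact_mod_cast ha1q
  have hsupp' : tsupport g ⊆ Icc (-a) a := hsupp.trans (Icc_subset_Icc (by linarith) hlog)
  set n := c.N + 1 with hn
  set nu := c.nuTab with hnu
  set M : ℕ → ℂ := weilMoment a g with hM
  set L := weilNorm1 g with hL
  set N2 := weilNorm2Sq g with hN2
  set z : ℕ → ℕ → ℝ := fun k l ↦ (conj (M k) * M l).re with hz
  have hzsym : ∀ k l, z k l = z l k := fun k l ↦ by
    rw [hz]; simp only; rw [← WeilAna.re_mul_conj_eq, mul_comm]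
  have hL0 : 0 ≤ L := weilNorm1_nonneg g
  have hN20 : 0 ≤ N2 := weilNorm2Sq_nonneg g
  have hL1 : L ^ 2 ≤ 2 * a * N2 := weilNorm1_sq_le hg ha hsupp'
  -- the three terms of E(g)
  set P : ℝ := 2 * (weilMellin g 0 * conj (weilMellin g 1)).re with hP
  set A : ℝ := ∫ t : ℝ, ‖weilMellin g (1 / 2 + t * I)‖ ^ 2 * Literature.Analysis.SpecialFunctions.reDigammaQuarter t with hA
  set Γ : ℝ := ∫ t : ℝ, ‖weilMellin g (1 / 2 + t * I)‖ ^ 2 * cellsGamma c.wL c.cells t with hΓ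
  have hE : weilArchQuadratic g = P - Real.log π * N2 + 1 / (2 * π) * A := by
    rw [weilArchQuadratic_eq]; rfl
  -- Step A
  set ρ : ℝ := 2 * (a / 2) ^ (c.N + 1) / (c.N + 1).factorial with hρ
  have hρ0 : 0 ≤ ρ := by positivity
  have hPA : ∑ k ∈ range n, ∑ l ∈ range n,
      (2 * ((-a / 2) ^ k / k.factorial) * ((a / 2) ^ l / l.factorial)) * z k l -
      (8 * ρ + 6 * ρ ^ 2) * L ^ 2 ≤ P := WeilAna.polar_lower_bound hg ha ha1 hsupp' c.N
  rw [polar_symmetrize n a z hzsym] at hPA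
  -- Step B
  have hB : (c.wL : ℝ) * (2 * π * N2) - Γ ≤ A := arch_lower_bound hcells hg
  -- Step C
  have hC : Γ ≤ ∑ k ∈ range n, ∑ l ∈ range n, gHat c k l * z k l + 5 * L ^ 2 * (c.nuPrime nu : ℝ) := by
    have := freq_integral_bound hcells hsc hg (by rwa [← ha_def])
    rw [← ha_def] at this
    exact this
  have hΓ0 : 0 ≤ Γ := integral_nonneg fun t ↦ mul_nonneg (sq_nonneg _) (cellsGamma_nonneg hcells t)
  -- constants
  set q : ℝ := ((invTwoPiHi : ℚ) : ℝ) with hq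
  have hq1 : 1 / (2 * π) ≤ q := invTwoPiHi_ge
  have hq0 : 0 ≤ q := invTwoPiHi_nonneg
  have hlogpi : Real.log π ≤ ((logPiHi : ℚ) : ℝ) := logPiHi_ge
  have hν0 : 0 ≤ ((c.nuPrime nu : ℚ) : ℝ) := by
    unfold nuPrime
    rw [hnu, getV_nuTab (by omega)]
    push_cast
    have ha0q : (0 : ℚ) ≤ c.a0 := by
      have := ha.le; rw [ha_def] at this; exact_mod_cast this
    have := nuQ_nonneg hcells ha0q (q := c.N + 1) ⟨c.nb, by omega⟩
    positivity
  have hpi : 0 < 1 / (2 * π) := by positivity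
  -- combine A, B, C
  have hB' : (c.wL : ℝ) * N2 - 1 / (2 * π) * Γ ≤ 1 / (2 * π) * A := by
    calc (c.wL : ℝ) * N2 - 1 / (2 * π) * Γ = 1 / (2 * π) * ((c.wL : ℝ) * (2 * π * N2) - Γ) := by
          field_simp
      _ ≤ 1 / (2 * π) * A := mul_le_mul_of_nonneg_left hB hpi.le
  have h3 : 1 / (2 * π) * Γ ≤ q * Γ := mul_le_mul_of_nonneg_right hq1 hΓ0
  have h4 : q * Γ ≤ q * (∑ k ∈ range n, ∑ l ∈ range n, gHat c k l * z k l +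
      5 * L ^ 2 * (c.nuPrime nu : ℝ)) := mul_le_mul_of_nonneg_left hC hq0
  have h5 : Real.log π * N2 ≤ ((logPiHi : ℚ) : ℝ) * N2 := mul_le_mul_of_nonneg_right hlogpi hN20
  have step1 : ∑ k ∈ range n, ∑ l ∈ range n,
      ((if k % 2 = l % 2 then
        (-1 : ℝ) ^ k * 2 * ((a / 2) ^ k / k.factorial) * ((a / 2) ^ l / l.factorial) else 0) -
        q * gHat c k l) * z k l +
      ((c.wL : ℝ) - (logPiHi : ℚ)) * N2 -
      ((8 * ρ + 6 * ρ ^ 2) + 5 * q * (c.nuPrime nu : ℝ)) * L ^ 2 ≤ weilArchQuadratic g := by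
    rw [hE]
    have e1 : ∑ k ∈ range n, ∑ l ∈ range n,
        ((if k % 2 = l % 2 then
          (-1 : ℝ) ^ k * 2 * ((a / 2) ^ k / k.factorial) * ((a / 2) ^ l / l.factorial) else 0) -
          q * gHat c k l) * z k l =
        ∑ k ∈ range n, ∑ l ∈ range n,
          (if k % 2 = l % 2 then
            (-1 : ℝ) ^ k * 2 * ((a / 2) ^ k / k.factorial) * ((a / 2) ^ l / l.factorial) else 0) * z k l -
        q * ∑ k ∈ range n, ∑ l ∈ range n, gHat c k l * z k l := by
      rw [Finset.mul_sum, ← Finset.sum_sub_distrib]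
      refine Finset.sum_congr rfl fun k _ ↦ ?_
      rw [Finset.mul_sum, ← Finset.sum_sub_distrib]
      refine Finset.sum_congr rfl fun l _ ↦ ?_
      ring
    rw [e1]
    linarith [hPA, hB', h3, h4, h5]
  -- rewrite the matrix as `pmQ`
  have step2 : ∑ k ∈ range n, ∑ l ∈ range n,
      ((if k % 2 = l % 2 then
        (-1 : ℝ) ^ k * 2 * ((a / 2) ^ k / k.factorial) * ((a / 2) ^ l / l.factorial) else 0) -
        q * gHat c k l) * z k l =
      ∑ k ∈ range n, ∑ l ∈ range n, ((c.pmQ nu k l : ℚ) : ℝ) * z k l := by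
    refine Finset.sum_congr rfl fun k hk ↦ Finset.sum_congr rfl fun l hl ↦ ?_
    rw [pmQ_cast (Finset.mem_range.1 hk) (Finset.mem_range.1 hl)]
  rw [step2] at step1
  -- rounding
  have hMk : ∀ k, ‖M k‖ ≤ L := fun k ↦ norm_weilMoment_le hg ha hsupp' k
  have hround : ∑ k ∈ range n, ∑ l ∈ range n, ((c.prQ nu k l : ℚ) : ℝ) * z k l -
      ∑ k ∈ range n, ∑ l ∈ range n, ((c.pmQ nu k l : ℚ) : ℝ) * z k l ≤
      1 / 2 ^ c.pg * (n : ℝ) ^ 2 * L ^ 2 :=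
    WeilAlg.quad_rounding_le n (fun k l ↦ ((c.prQ nu k l : ℚ) : ℝ))
      (fun k l ↦ ((c.pmQ nu k l : ℚ) : ℝ)) (1 / 2 ^ c.pg) L (fun k l ↦ by
        rw [abs_sub_comm]
        unfold prQ
        exact abs_cast_sub_ratRd_le c.pg (c.pmQ nu k l)) M hMk
  -- κ_exact
  have hcoef : 0 ≤ (8 * ρ + 6 * ρ ^ 2) + 5 * q * (c.nuPrime nu : ℝ) + 1 / 2 ^ c.pg * (n : ℝ) ^ 2 := by
    positivity
  have hkex : ((c.kappaExact nu : ℚ) : ℝ) =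
      ((c.wL : ℝ) - (logPiHi : ℚ)) -
        2 * a * ((8 * ρ + 6 * ρ ^ 2) + 5 * q * (c.nuPrime nu : ℝ) + 1 / 2 ^ c.pg * (n : ℝ) ^ 2) := by
    unfold kappaExact etaP rhoE
    push_cast
    rw [hρ, hq, hn, ha_def]
    push_cast
    ring
  have hκle : ((c.kappaQ nu : ℚ) : ℝ) ≤ ((c.kappaExact nu : ℚ) : ℝ) := by
    unfold kappaQ; exact_mod_cast ratRd_le c.pg _
  have hκ0 : (0 : ℝ) ≤ ((c.kappaQ nu : ℚ) : ℝ) := by exact_mod_cast hκ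
  -- E ≥ Σ pr z + κ N2
  have step3 : ∑ k ∈ range n, ∑ l ∈ range n, ((c.prQ nu k l : ℚ) : ℝ) * z k l +
      ((c.kappaQ nu : ℚ) : ℝ) * N2 ≤ weilArchQuadratic g := by
    have h1 : ((c.kappaQ nu : ℚ) : ℝ) * N2 ≤ ((c.kappaExact nu : ℚ) : ℝ) * N2 :=
      mul_le_mul_of_nonneg_right hκle hN20
    rw [hkex] at h1
    have h2 := mul_le_mul_of_nonneg_left hL1 hcoef
    linarith [step1, hround, h1, h2]
  -- Bessel and the algebraic core
  have hbes : 2 * (∑ k ∈ range n, conj (c.uVec M k) * M k).re -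
      (∑ k ∈ range n, ∑ l ∈ range n, conj (c.uVec M k) * c.uVec M l * (gramH a k l : ℂ)).re ≤ N2 :=
    weilNorm2Sq_ge_bessel hg ha hsupp' n (c.uVec M)
  have hcore : 0 ≤ (∑ k ∈ range n, ∑ l ∈ range n, ((c.prQ nu k l : ℚ) : ℝ) * z k l) +
      ((c.kappaQ nu : ℚ) : ℝ) *
        (2 * (∑ k ∈ range n, conj (c.uVec M k) * M k).re -
          (∑ k ∈ range n, ∑ l ∈ range n,
            conj (c.uVec M k) * c.uVec M l * (gramH a k l : ℂ)).re) := by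
    have := core_nonneg (c := c) (nu := nu) hN hb0 hb1 a ha_def.symm M
    rw [← hn] at this
    exact this
  have h4 := mul_le_mul_of_nonneg_left hbes hκ0
  linarith [step3, h4, hcore]

end WeilCert


end Literature.NumberTheory.LFunctions
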